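import Mathlib
import Literature.MathematicalPhysics.QuantumFieldTheory.Balaban1983to89.Beta.ComposedRoad
import Literature.MathematicalPhysics.QuantumFieldTheory.Balaban1983to89.Beta.ScalewiseVectorSeam
import Summits.QuantumFields.BalabanUV.Beta.FixedPointIdentification

/-!
# Road «FP» (binder row D1), leaf N7 — THE ASYMPTOTIC HYPOTHESIS `hasym` BY TYPE from a leg interface

Road FP's END (`FP/StepLawKHolds.d1Drift_JsBalOf_of_rows_bounded`, `FP/RoadPinnedHolds.…`) asks for ONE asymptotic
input about ONE real sequence `g` (there `g m = fPerf Lc … m`, the one-loop coefficient of the perfect `m`-fold step,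
which by REBASE is the perfect ONE-step coefficient at base `Lc^m`):

  `hasym : ∀ m ≥ 1, |g m − m · stepBal N Lc| ≤ Cg`.

This file derives `hasym` from the cell's ABSTRACT composed-road END
`ComposedRoad.oneLoopDrift_of_composedLegInterfacePow_identity` at the TAUTOLOGICAL split `β⁰_j := g (j+1) − g j`
(the device of `ScalewiseVectorSeam.oneShotSide_drift`): the END's `hident` becomes the window representation
  `REP∞ : |g m − g 0 − Σ_{‖w‖ ≤ R₀} w_μ w_ν Σ_i cc₀ i · F′ i (Lc^m) w · G′ i (Lc^m) w| ≤ U`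
of the increment `g m − g 0` by a leg bilinear at blocking `Lc^m`, and its conclusion `OneLoopDrift (stepBal N Lc) A β⁰`
telescopes to `|g m − g 0 − m·stepBal N Lc| ≤ A`, i.e. `hasym` with `Cg := A + |g 0|`.  No step law is used here; with the
step law, `FixedPointIdentification.value_eq_stepBal_of_step_law_bounded` then gives the VALUE `g 1 = stepBal N Lc`.

All statements are about our own objects / abstract sequences; [folklore] throughout.  HONEST FRAMING: bookkeeping toward
`hident` (GAPS O-asym1-7); discharges nothing of `BetaPertH`; NOT the continuum limit, NOT Clay.
-/

namespace Summit.QuantumFields.BalabanUV.Beta.FP.AsymptoticEnd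

open Finset
open Literature.Probability.LatticeModels (annulus)
open Literature.MathematicalPhysics.QuantumFieldTheory.Balaban1983to89
open Literature.MathematicalPhysics.QuantumFieldTheory.Balaban1983to89.Beta
open Literature.MathematicalPhysics.QuantumFieldTheory.Balaban1983to89.Beta.TransverseStructure (E4)
open Literature.MathematicalPhysics.QuantumFieldTheory.Balaban1983to89.Beta.LeadingCoefficient (leadingIntegrand kappaBal transverseValue)
open Literature.MathematicalPhysics.QuantumFieldTheory.Balaban1983to89.Beta.DyadicShell (Pt toReal supNorm)
open Literature.MathematicalPhysics.QuantumFieldTheory.Balaban1983to89.Beta.LargeLWindow.WindowDecomposition (constA)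
open Literature.MathematicalPhysics.QuantumFieldTheory.Balaban1983to89.Beta.BubbleTransfer (Leg contBubble bubbleConst)
open Literature.MathematicalPhysics.QuantumFieldTheory.Balaban1983to89.Beta.Drift (OneLoopDrift)
open Literature.MathematicalPhysics.QuantumFieldTheory.Balaban1983to89.Beta.MarginalTelescoping (composedCoeff IdentityForm)
open Literature.MathematicalPhysics.QuantumFieldTheory.Balaban1983to89.Beta.ScalewiseVectorSeam (splitOf)
open Summit.QuantumFields.BalabanUV.Beta.FixedPointIdentification

/-! ## §1 The tautological carrier `μC j k := g (j+1) − g j` -/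

/-- The increment family of a sequence. [folklore] -/
theorem composedCoeff_incr (g : ℕ → ℝ) (m : ℕ) :
    composedCoeff (fun j _ => g (j + 1) - g j) m = g m - g 0 := by
  unfold composedCoeff
  exact Finset.sum_range_sub g m

/-- The increment family is (trivially) of identity shape with `β⁰_j = g (j+1) − g j`. [folklore] -/
theorem identityForm_incr (g : ℕ → ℝ) :
    IdentityForm (fun j _ => g (j + 1) - g j) (splitOf fun j => g (j + 1) - g j).β0 :=
  fun _ _ _ => rfl

/-- A drift bound for the increments telescopes to the asymptotic bound for the sequence. [folklore] -/
theorem asym_of_oneLoopDrift_incr {g : ℕ → ℝ} {s A : ℝ} (h : OneLoopDrift s A fun j => g (j + 1) - g j) (m : ℕ) :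
    |g m - (m : ℝ) * s| ≤ A + |g 0| := by
  have hm := h m
  rw [Finset.sum_range_sub] at hm
  have : g m - (m : ℝ) * s = (g m - g 0 - s * m) + g 0 := by ring
  rw [this]
  exact (abs_add_le _ _).trans (by gcongr)

/-- Conversely-shaped bookkeeping: the asymptotic bound in road FP's `hasym` form, `∀ m ≥ 1`. [folklore] -/
theorem hasym_of_oneLoopDrift_incr {g : ℕ → ℝ} {s A : ℝ} (h : OneLoopDrift s A fun j => g (j + 1) - g j) :
    ∀ m : ℕ, 1 ≤ m → |g m - (m : ℝ) * s| ≤ A + |g 0| :=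
  fun m _ => asym_of_oneLoopDrift_incr h m

/-! ## §2 `hasym` from the abstract leg interface (the cell's composed-road END at the tautological split) -/

section LegInterface

variable {ι : Type*} {s : Finset ι} {cc₀ : ι → ℝ} {P Q : ι → Leg}

/-- **LEAF N7 BY TYPE.**  For ANY real sequence `g`: an abstract leg table `(s, cc₀, P, Q)` of total degree 6 whose continuum
bubble is `leadingIntegrand (kappaBal N)`, one-shot legs `F′ G′` at blocking `Lc^m` within the table's window / tail envelopes,
and the window REPRESENTATION of the increments `g m − g 0` by the leg bilinear (`hrep`, = the END's `hident` at the
tautological split) give road FP's asymptotic hypothesis `∀ m ≥ 1, |g m − m·stepBal N Lc| ≤ Cg` with an explicit `Cg`. [folklore] -/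
theorem hasym_of_legInterface (g : ℕ → ℝ)
    (hdeg : ∀ i ∈ s, (P i).a + (Q i).a = 6) {μ ν : Fin 4} (hμν : μ ≠ ν) {N : ℝ} (hN : N ≠ 0)
    (hval : ∀ x : E4, x ≠ 0 → x μ * x ν * contBubble s cc₀ P Q x = leadingIntegrand (kappaBal N) μ ν x)
    {Lc : ℕ} (hL : 2 ≤ Lc)
    {F' G' : ι → ℕ → Pt → ℝ} {R S' R' Sg : ι → ℝ} {δ U cc : ℝ} {M : ℕ → ℕ}
    (hR : ∀ i ∈ s, 0 ≤ R i) (hS : ∀ i ∈ s, 0 ≤ Sg i) (hR' : ∀ i ∈ s, 0 ≤ R' i) (hS' : ∀ i ∈ s, 0 ≤ S' i) (hδ : 0 < δ)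
    (hc : 1 ≤ cc) (hM : ∀ L : ℕ, 2 ≤ L → 1 ≤ M L ∧ (L : ℝ) ≤ cc * M L) (hML : ∀ L : ℕ, 2 ≤ L → M L ≤ L)
    (hF : ∀ m : ℕ, 1 ≤ m → ∀ w ∈ annulus 4 0 (M (Lc ^ m)), ∀ i ∈ s,
      |F' i (Lc ^ m) w - (P i).f (Lc ^ m) 0 w| ≤ R i / ((supNorm w : ℝ) ^ ((P i).a - 2) * ((Lc ^ m : ℕ) : ℝ) ^ 2))
    (hG : ∀ m : ℕ, 1 ≤ m → ∀ w ∈ annulus 4 0 (M (Lc ^ m)), ∀ i ∈ s,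
      |G' i (Lc ^ m) w - (Q i).f (Lc ^ m) 0 w| ≤ Sg i / ((supNorm w : ℝ) ^ ((Q i).a - 2) * ((Lc ^ m : ℕ) : ℝ) ^ 2))
    (hFtail : ∀ m : ℕ, 1 ≤ m → ∀ r : ℕ, M (Lc ^ m) ≤ r → ∀ w ∈ annulus 4 r (r + 1), ∀ i ∈ s,
      |F' i (Lc ^ m) w| ≤ R' i / ((r : ℝ) + 1) ^ (P i).a * Real.exp (-(δ / ((Lc ^ m : ℕ) : ℝ)) * ((r : ℝ) + 1)))
    (hGtail : ∀ m : ℕ, 1 ≤ m → ∀ r : ℕ, M (Lc ^ m) ≤ r → ∀ w ∈ annulus 4 r (r + 1), ∀ i ∈ s,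
      |G' i (Lc ^ m) w| ≤ S' i / ((r : ℝ) + 1) ^ (Q i).a)
    (hrep : ∀ m : ℕ, 1 ≤ m → ∃ R₀ : ℕ, M (Lc ^ m) ≤ R₀ ∧
      |g m - g 0 - ∑ w ∈ annulus 4 0 R₀, toReal w μ * toReal w ν *
        ∑ i ∈ s, cc₀ i * (F' i (Lc ^ m) w * G' i (Lc ^ m) w)| ≤ U) :
    ∀ m : ℕ, 1 ≤ m → |g m - (m : ℝ) * B12Normalization.stepBal N Lc| ≤
      constA (|kappaBal N| * 24 + |kappaBal N| * 110592) (bubbleConst s cc₀ P Q)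
          ((80 * (∑ i ∈ s, |cc₀ i| * (R' i * S' i)) * (1 + cc / δ) + U) +
            80 * ∑ i ∈ s, |cc₀ i| * ((((P i).A + (P i).B) * Sg i + R i * ((Q i).A + (Q i).B) + R i * Sg i)))
          cc (kappaBal N * transverseValue) + |g 0| := by
  have hident : ∀ m : ℕ, 1 ≤ m → ∃ R₀ : ℕ, M (Lc ^ m) ≤ R₀ ∧
      |composedCoeff (fun j _ => g (j + 1) - g j) m - ∑ w ∈ annulus 4 0 R₀, toReal w μ * toReal w ν *
        ∑ i ∈ s, cc₀ i * (F' i (Lc ^ m) w * G' i (Lc ^ m) w)| ≤ U := by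
    intro m hm
    rw [composedCoeff_incr]
    exact hrep m hm
  have h := ComposedRoad.oneLoopDrift_of_composedLegInterfacePow_identity (splitOf fun j => g (j + 1) - g j)
    hdeg hμν hN hval hL hR hS hR' hS' hδ hc hM hML hF hG hFtail hGtail hident (identityForm_incr g)
  exact hasym_of_oneLoopDrift_incr h

/-- **LEAF N7 BY TYPE, existential constant** (the shape of road FP's `hasym` binder). [folklore] -/
theorem exists_hasym_of_legInterface (g : ℕ → ℝ)
    (hdeg : ∀ i ∈ s, (P i).a + (Q i).a = 6) {μ ν : Fin 4} (hμν : μ ≠ ν) {N : ℝ} (hN : N ≠ 0)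
    (hval : ∀ x : E4, x ≠ 0 → x μ * x ν * contBubble s cc₀ P Q x = leadingIntegrand (kappaBal N) μ ν x)
    {Lc : ℕ} (hL : 2 ≤ Lc)
    {F' G' : ι → ℕ → Pt → ℝ} {R S' R' Sg : ι → ℝ} {δ U cc : ℝ} {M : ℕ → ℕ}
    (hR : ∀ i ∈ s, 0 ≤ R i) (hS : ∀ i ∈ s, 0 ≤ Sg i) (hR' : ∀ i ∈ s, 0 ≤ R' i) (hS' : ∀ i ∈ s, 0 ≤ S' i) (hδ : 0 < δ)
    (hc : 1 ≤ cc) (hM : ∀ L : ℕ, 2 ≤ L → 1 ≤ M L ∧ (L : ℝ) ≤ cc * M L) (hML : ∀ L : ℕ, 2 ≤ L → M L ≤ L)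
    (hF : ∀ m : ℕ, 1 ≤ m → ∀ w ∈ annulus 4 0 (M (Lc ^ m)), ∀ i ∈ s,
      |F' i (Lc ^ m) w - (P i).f (Lc ^ m) 0 w| ≤ R i / ((supNorm w : ℝ) ^ ((P i).a - 2) * ((Lc ^ m : ℕ) : ℝ) ^ 2))
    (hG : ∀ m : ℕ, 1 ≤ m → ∀ w ∈ annulus 4 0 (M (Lc ^ m)), ∀ i ∈ s,
      |G' i (Lc ^ m) w - (Q i).f (Lc ^ m) 0 w| ≤ Sg i / ((supNorm w : ℝ) ^ ((Q i).a - 2) * ((Lc ^ m : ℕ) : ℝ) ^ 2))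
    (hFtail : ∀ m : ℕ, 1 ≤ m → ∀ r : ℕ, M (Lc ^ m) ≤ r → ∀ w ∈ annulus 4 r (r + 1), ∀ i ∈ s,
      |F' i (Lc ^ m) w| ≤ R' i / ((r : ℝ) + 1) ^ (P i).a * Real.exp (-(δ / ((Lc ^ m : ℕ) : ℝ)) * ((r : ℝ) + 1)))
    (hGtail : ∀ m : ℕ, 1 ≤ m → ∀ r : ℕ, M (Lc ^ m) ≤ r → ∀ w ∈ annulus 4 r (r + 1), ∀ i ∈ s,
      |G' i (Lc ^ m) w| ≤ S' i / ((r : ℝ) + 1) ^ (Q i).a)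
    (hrep : ∀ m : ℕ, 1 ≤ m → ∃ R₀ : ℕ, M (Lc ^ m) ≤ R₀ ∧
      |g m - g 0 - ∑ w ∈ annulus 4 0 R₀, toReal w μ * toReal w ν *
        ∑ i ∈ s, cc₀ i * (F' i (Lc ^ m) w * G' i (Lc ^ m) w)| ≤ U) :
    ∃ Cg : ℝ, ∀ m : ℕ, 1 ≤ m → |g m - (m : ℝ) * B12Normalization.stepBal N Lc| ≤ Cg :=
  ⟨_, hasym_of_legInterface g hdeg hμν hN hval hL hR hS hR' hS' hδ hc hM hML hF hG hFtail hGtail hrep⟩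

/-- **LEAF N7 + THE STEP LAW ⟹ THE VALUE.**  With the step law on top of the leg interface, the first member is identified:
`g 1 = stepBal N Lc` (road FP's N8; `FixedPointIdentification.value_eq_stepBal_of_step_law_bounded`). [folklore] -/
theorem value_eq_stepBal_of_legInterface_step_law (g : ℕ → ℝ)
    (hdeg : ∀ i ∈ s, (P i).a + (Q i).a = 6) {μ ν : Fin 4} (hμν : μ ≠ ν) {N : ℝ} (hN : N ≠ 0)
    (hval : ∀ x : E4, x ≠ 0 → x μ * x ν * contBubble s cc₀ P Q x = leadingIntegrand (kappaBal N) μ ν x)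
    {Lc : ℕ} (hL : 2 ≤ Lc)
    {F' G' : ι → ℕ → Pt → ℝ} {R S' R' Sg : ι → ℝ} {δ U cc : ℝ} {M : ℕ → ℕ}
    (hR : ∀ i ∈ s, 0 ≤ R i) (hS : ∀ i ∈ s, 0 ≤ Sg i) (hR' : ∀ i ∈ s, 0 ≤ R' i) (hS' : ∀ i ∈ s, 0 ≤ S' i) (hδ : 0 < δ)
    (hc : 1 ≤ cc) (hM : ∀ L : ℕ, 2 ≤ L → 1 ≤ M L ∧ (L : ℝ) ≤ cc * M L) (hML : ∀ L : ℕ, 2 ≤ L → M L ≤ L)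
    (hF : ∀ m : ℕ, 1 ≤ m → ∀ w ∈ annulus 4 0 (M (Lc ^ m)), ∀ i ∈ s,
      |F' i (Lc ^ m) w - (P i).f (Lc ^ m) 0 w| ≤ R i / ((supNorm w : ℝ) ^ ((P i).a - 2) * ((Lc ^ m : ℕ) : ℝ) ^ 2))
    (hG : ∀ m : ℕ, 1 ≤ m → ∀ w ∈ annulus 4 0 (M (Lc ^ m)), ∀ i ∈ s,
      |G' i (Lc ^ m) w - (Q i).f (Lc ^ m) 0 w| ≤ Sg i / ((supNorm w : ℝ) ^ ((Q i).a - 2) * ((Lc ^ m : ℕ) : ℝ) ^ 2))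
    (hFtail : ∀ m : ℕ, 1 ≤ m → ∀ r : ℕ, M (Lc ^ m) ≤ r → ∀ w ∈ annulus 4 r (r + 1), ∀ i ∈ s,
      |F' i (Lc ^ m) w| ≤ R' i / ((r : ℝ) + 1) ^ (P i).a * Real.exp (-(δ / ((Lc ^ m : ℕ) : ℝ)) * ((r : ℝ) + 1)))
    (hGtail : ∀ m : ℕ, 1 ≤ m → ∀ r : ℕ, M (Lc ^ m) ≤ r → ∀ w ∈ annulus 4 r (r + 1), ∀ i ∈ s,
      |G' i (Lc ^ m) w| ≤ S' i / ((r : ℝ) + 1) ^ (Q i).a)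
    (hrep : ∀ m : ℕ, 1 ≤ m → ∃ R₀ : ℕ, M (Lc ^ m) ≤ R₀ ∧
      |g m - g 0 - ∑ w ∈ annulus 4 0 R₀, toReal w μ * toReal w ν *
        ∑ i ∈ s, cc₀ i * (F' i (Lc ^ m) w * G' i (Lc ^ m) w)| ≤ U)
    (hstep : ∀ m : ℕ, 1 ≤ m → g (m + 1) = g m + g 1) :
    g 1 = B12Normalization.stepBal N Lc := by
  obtain ⟨Cg, hasym⟩ := exists_hasym_of_legInterface g hdeg hμν hN hval hL hR hS hR' hS' hδ hc hM hML hF hG hFtail hGtail hrep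
  -- the step law gives the power law `g m = m · g 1` (`m ≥ 1`)
  have hpow : ∀ m : ℕ, 1 ≤ m → g m = (m : ℝ) * g 1 := by
    intro m hm
    induction m with
    | zero => exact absurd hm (by norm_num)
    | succ m ih =>
      rcases Nat.eq_zero_or_pos m with h0 | hpos
      · subst h0; simp
      · rw [hstep m hpos, ih hpos]; push_cast; ring
  refine eq_of_nat_mul_sub_bounded (C := max Cg 0) fun m => ?_
  rcases Nat.eq_zero_or_pos m with h0 | hpos
  · subst h0; simp
  · have := hasym m hpos
    rw [hpow m hpos] at this
    rw [mul_sub]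
    exact this.trans (le_max_left _ _)

end LegInterface

/-! ## §3 (v1.1) Free reference constant: `hrep` about `g m − c₀` for any `c₀` (the value `g 0` is never used by road FP) -/

section LegInterfaceRef

variable {ι : Type*} {s : Finset ι} {cc₀ : ι → ℝ} {P Q : ι → Leg}

/-- **LEAF N7 BY TYPE, free reference constant.**  As `hasym_of_legInterface`, with the window representation stated for
`g m − c₀` with an ARBITRARY constant `c₀` (e.g. `c₀ = 0`: the perfect `m`-fold coefficient itself is represented by its one-shot
leg bilinear up to `U`); conclusion `∀ m ≥ 1, |g m − m·stepBal N Lc| ≤ A + |c₀|`. [folklore] -/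
theorem hasym_of_legInterface_ref (g : ℕ → ℝ) (c₀ : ℝ)
    (hdeg : ∀ i ∈ s, (P i).a + (Q i).a = 6) {μ ν : Fin 4} (hμν : μ ≠ ν) {N : ℝ} (hN : N ≠ 0)
    (hval : ∀ x : E4, x ≠ 0 → x μ * x ν * contBubble s cc₀ P Q x = leadingIntegrand (kappaBal N) μ ν x)
    {Lc : ℕ} (hL : 2 ≤ Lc)
    {F' G' : ι → ℕ → Pt → ℝ} {R S' R' Sg : ι → ℝ} {δ U cc : ℝ} {M : ℕ → ℕ}
    (hR : ∀ i ∈ s, 0 ≤ R i) (hS : ∀ i ∈ s, 0 ≤ Sg i) (hR' : ∀ i ∈ s, 0 ≤ R' i) (hS' : ∀ i ∈ s, 0 ≤ S' i) (hδ : 0 < δ)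
    (hc : 1 ≤ cc) (hM : ∀ L : ℕ, 2 ≤ L → 1 ≤ M L ∧ (L : ℝ) ≤ cc * M L) (hML : ∀ L : ℕ, 2 ≤ L → M L ≤ L)
    (hF : ∀ m : ℕ, 1 ≤ m → ∀ w ∈ annulus 4 0 (M (Lc ^ m)), ∀ i ∈ s,
      |F' i (Lc ^ m) w - (P i).f (Lc ^ m) 0 w| ≤ R i / ((supNorm w : ℝ) ^ ((P i).a - 2) * ((Lc ^ m : ℕ) : ℝ) ^ 2))
    (hG : ∀ m : ℕ, 1 ≤ m → ∀ w ∈ annulus 4 0 (M (Lc ^ m)), ∀ i ∈ s,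
      |G' i (Lc ^ m) w - (Q i).f (Lc ^ m) 0 w| ≤ Sg i / ((supNorm w : ℝ) ^ ((Q i).a - 2) * ((Lc ^ m : ℕ) : ℝ) ^ 2))
    (hFtail : ∀ m : ℕ, 1 ≤ m → ∀ r : ℕ, M (Lc ^ m) ≤ r → ∀ w ∈ annulus 4 r (r + 1), ∀ i ∈ s,
      |F' i (Lc ^ m) w| ≤ R' i / ((r : ℝ) + 1) ^ (P i).a * Real.exp (-(δ / ((Lc ^ m : ℕ) : ℝ)) * ((r : ℝ) + 1)))
    (hGtail : ∀ m : ℕ, 1 ≤ m → ∀ r : ℕ, M (Lc ^ m) ≤ r → ∀ w ∈ annulus 4 r (r + 1), ∀ i ∈ s,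
      |G' i (Lc ^ m) w| ≤ S' i / ((r : ℝ) + 1) ^ (Q i).a)
    (hrep : ∀ m : ℕ, 1 ≤ m → ∃ R₀ : ℕ, M (Lc ^ m) ≤ R₀ ∧
      |g m - c₀ - ∑ w ∈ annulus 4 0 R₀, toReal w μ * toReal w ν *
        ∑ i ∈ s, cc₀ i * (F' i (Lc ^ m) w * G' i (Lc ^ m) w)| ≤ U) :
    ∀ m : ℕ, 1 ≤ m → |g m - (m : ℝ) * B12Normalization.stepBal N Lc| ≤
      constA (|kappaBal N| * 24 + |kappaBal N| * 110592) (bubbleConst s cc₀ P Q)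
          ((80 * (∑ i ∈ s, |cc₀ i| * (R' i * S' i)) * (1 + cc / δ) + U) +
            80 * ∑ i ∈ s, |cc₀ i| * ((((P i).A + (P i).B) * Sg i + R i * ((Q i).A + (Q i).B) + R i * Sg i)))
          cc (kappaBal N * transverseValue) + |c₀| := by
  -- re-base the sequence at `0`
  set g' : ℕ → ℝ := fun m => if m = 0 then c₀ else g m with hg'
  have hg'0 : g' 0 = c₀ := by simp [hg']
  have hg'm : ∀ m : ℕ, 1 ≤ m → g' m = g m := fun m hm => by
    have : m ≠ 0 := by omega
    simp [hg', this]
  have hrep' : ∀ m : ℕ, 1 ≤ m → ∃ R₀ : ℕ, M (Lc ^ m) ≤ R₀ ∧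
      |g' m - g' 0 - ∑ w ∈ annulus 4 0 R₀, toReal w μ * toReal w ν *
        ∑ i ∈ s, cc₀ i * (F' i (Lc ^ m) w * G' i (Lc ^ m) w)| ≤ U := fun m hm => by
    rw [hg'm m hm, hg'0]; exact hrep m hm
  intro m hm
  have h := hasym_of_legInterface g' hdeg hμν hN hval hL hR hS hR' hS' hδ hc hM hML hF hG hFtail hGtail hrep' m hm
  rwa [hg'm m hm, hg'0] at h

/-- **LEAF N7 BY TYPE, free reference constant, existential form.** [folklore] -/
theorem exists_hasym_of_legInterface_ref (g : ℕ → ℝ) (c₀ : ℝ)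
    (hdeg : ∀ i ∈ s, (P i).a + (Q i).a = 6) {μ ν : Fin 4} (hμν : μ ≠ ν) {N : ℝ} (hN : N ≠ 0)
    (hval : ∀ x : E4, x ≠ 0 → x μ * x ν * contBubble s cc₀ P Q x = leadingIntegrand (kappaBal N) μ ν x)
    {Lc : ℕ} (hL : 2 ≤ Lc)
    {F' G' : ι → ℕ → Pt → ℝ} {R S' R' Sg : ι → ℝ} {δ U cc : ℝ} {M : ℕ → ℕ}
    (hR : ∀ i ∈ s, 0 ≤ R i) (hS : ∀ i ∈ s, 0 ≤ Sg i) (hR' : ∀ i ∈ s, 0 ≤ R' i) (hS' : ∀ i ∈ s, 0 ≤ S' i) (hδ : 0 < δ)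
    (hc : 1 ≤ cc) (hM : ∀ L : ℕ, 2 ≤ L → 1 ≤ M L ∧ (L : ℝ) ≤ cc * M L) (hML : ∀ L : ℕ, 2 ≤ L → M L ≤ L)
    (hF : ∀ m : ℕ, 1 ≤ m → ∀ w ∈ annulus 4 0 (M (Lc ^ m)), ∀ i ∈ s,
      |F' i (Lc ^ m) w - (P i).f (Lc ^ m) 0 w| ≤ R i / ((supNorm w : ℝ) ^ ((P i).a - 2) * ((Lc ^ m : ℕ) : ℝ) ^ 2))
    (hG : ∀ m : ℕ, 1 ≤ m → ∀ w ∈ annulus 4 0 (M (Lc ^ m)), ∀ i ∈ s,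
      |G' i (Lc ^ m) w - (Q i).f (Lc ^ m) 0 w| ≤ Sg i / ((supNorm w : ℝ) ^ ((Q i).a - 2) * ((Lc ^ m : ℕ) : ℝ) ^ 2))
    (hFtail : ∀ m : ℕ, 1 ≤ m → ∀ r : ℕ, M (Lc ^ m) ≤ r → ∀ w ∈ annulus 4 r (r + 1), ∀ i ∈ s,
      |F' i (Lc ^ m) w| ≤ R' i / ((r : ℝ) + 1) ^ (P i).a * Real.exp (-(δ / ((Lc ^ m : ℕ) : ℝ)) * ((r : ℝ) + 1)))
    (hGtail : ∀ m : ℕ, 1 ≤ m → ∀ r : ℕ, M (Lc ^ m) ≤ r → ∀ w ∈ annulus 4 r (r + 1), ∀ i ∈ s,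
      |G' i (Lc ^ m) w| ≤ S' i / ((r : ℝ) + 1) ^ (Q i).a)
    (hrep : ∀ m : ℕ, 1 ≤ m → ∃ R₀ : ℕ, M (Lc ^ m) ≤ R₀ ∧
      |g m - c₀ - ∑ w ∈ annulus 4 0 R₀, toReal w μ * toReal w ν *
        ∑ i ∈ s, cc₀ i * (F' i (Lc ^ m) w * G' i (Lc ^ m) w)| ≤ U) :
    ∃ Cg : ℝ, ∀ m : ℕ, 1 ≤ m → |g m - (m : ℝ) * B12Normalization.stepBal N Lc| ≤ Cg :=
  ⟨_, hasym_of_legInterface_ref g c₀ hdeg hμν hN hval hL hR hS hR' hS' hδ hc hM hML hF hG hFtail hGtail hrep⟩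

end LegInterfaceRef

end Summit.QuantumFields.BalabanUV.Beta.FP.AsymptoticEnd
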